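import Mathlib
import Literature.NumberTheory.GaloisRepresentations.HeckeCharacterArchTypeProofs
import Literature.NumberTheory.GaloisRepresentations.AlgebraicHeckeCharacterGrossencharakterProofs

/-!
# Hecke characters: products, finite order and unitary archimedean types as infinity types

Helper file for item stmt-Langlands-13760 (route `PicardMuOrdinary`, decl `ResidualAutomorphyEven`).
Bookkeeping on idelic Hecke characters of a number field `L` (tree: `HeckeCharacter`), used to build
the algebraic Hecke character `θ = ε · ψ · χ₀` of the CM cubic resolvent field that is induced to
`GL₃ / ℚ(ω)`:

* values at uniformizers and unramifiedness of a product (`valueAtUniformizer_mul'`,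
  `isUnramifiedAt_mul'`), unramifiedness almost everywhere (`eventually_isUnramifiedAt'`);
* a Hecke character of finite order has the trivial infinity type `(0, 0)`
  (`hasInfinityType_zero_of_isFiniteOrder`, the proof of the tree's
  `HeckeCharacter.IsFiniteOrder.isAlgebraic` with the exponents made explicit);
* the infinity type of a product is the sum of the infinity types (`HasInfinityType.mul'`);
* a Hecke character of unitary archimedean type `(2k, 0)` — `ψ((x,1)) = ∏_w (ι_w x_w/|ι_w x_w|)^{2k_w}`
  — has the (algebraic) infinity type `(-k, k)`: `(z/|z|)^{2k} = z^{k} z̄^{-k}`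
  (`hasInfinityType_of_hasUnitaryArchType_two_mul`).
-/

set_option linter.dupNamespace false -- project-wide option (lakefile weak.linter.dupNamespace); `Summit.Langlands.Langlands` is the mandated namespace

noncomputable section

namespace Summit.Langlands.Langlands.Theorems.ResidualAutomorphyEven

open NumberField NumberField.InfinitePlace NumberField.InfinitePlace.Completion IsDedekindDomain Filter
open Literature.NumberTheory.GaloisRepresentations
open scoped ComplexConjugate

variable {L : Type*} [Field L] [NumberField L]

/-! ### Products -/

/-- `(χψ)(ϖ_v) = χ(ϖ_v) ψ(ϖ_v)`. -/
theorem valueAtUniformizer_mul' (χ ψ : HeckeCharacter L) (v : HeightOneSpectrum (𝓞 L)) :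
    (χ * ψ).valueAtUniformizer v = χ.valueAtUniformizer v * ψ.valueAtUniformizer v := by
  simp only [HeckeCharacter.valueAtUniformizer, HeckeCharacter.localComponent_apply, HeckeCharacter.mul_apply,
    Units.val_mul]

/-- `χψ` is unramified where `χ` and `ψ` are. -/
theorem isUnramifiedAt_mul' {χ ψ : HeckeCharacter L} {v : HeightOneSpectrum (𝓞 L)} (hχ : χ.IsUnramifiedAt v)
    (hψ : ψ.IsUnramifiedAt v) : (χ * ψ).IsUnramifiedAt v := fun u => by
  have h1 := hχ u
  have h2 := hψ u
  rw [HeckeCharacter.localComponent_apply] at h1 h2 ⊢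
  rw [HeckeCharacter.mul_apply, h1, h2, mul_one]

/-- A Hecke character is unramified at all but finitely many places. -/
theorem eventually_isUnramifiedAt' (χ : HeckeCharacter L) :
    ∀ᶠ v : HeightOneSpectrum (𝓞 L) in cofinite, χ.IsUnramifiedAt v :=
  (HeckeCharacter.finite_ramifiedPlaces_iff χ).mp χ.finite_ramifiedPlaces_holds

/-! ### Infinity types: finite order, products -/

/-- The embedding `(L ⊗ ℝ)ˣ ↪ 𝕀_L`, `x ↦ (x, 1)`, is continuous. -/
theorem continuous_infiniteIdeles' : Continuous (infiniteIdeles L) := by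
  refine Continuous.units_map (MonoidHom.inl (InfiniteAdeleRing L) (FiniteAdeleRing (𝓞 L) L)) ?_
  exact continuous_id.prodMk continuous_const

/-- **A Hecke character of finite order has the trivial infinity type `(0, 0)`**: if `χⁿ = 1` then
`x ↦ χ(x, 1)` is continuous on `(L ⊗ ℝ)ˣ` with values in the `n`-th roots of unity, hence `= 1` on the
open neighbourhood of `1` where it avoids the finitely many roots of unity `≠ 1`. -/
theorem hasInfinityType_zero_of_isFiniteOrder {χ : HeckeCharacter L} (hχ : χ.IsFiniteOrder) :
    χ.HasInfinityType 0 0 := by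
  obtain ⟨n, hn, h1⟩ := hχ.exists_pow_eq_one
  set f : (InfiniteAdeleRing L)ˣ → ℂ := fun x => (χ (infiniteIdeles L x) : ℂ) with hf
  have hcont : Continuous f :=
    Units.continuous_val.comp ((map_continuous χ).comp continuous_infiniteIdeles')
  have hpow : ∀ x, f x ^ n = 1 := fun x => by
    have h := congrArg (fun φ : HeckeCharacter L => ((φ (infiniteIdeles L x) : ℂˣ) : ℂ)) h1
    simpa [HeckeCharacter.pow_apply, Units.val_pow_eq_pow_val] using h
  set S : Set ℂ := {z | z ^ n = 1 ∧ z ≠ 1} with hS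
  have hSfin : S.Finite := by
    refine (Multiset.finite_toSet (Polynomial.nthRoots n (1 : ℂ))).subset fun z hz => ?_
    simp only [Set.mem_setOf_eq] at hz ⊢
    exact (Polynomial.mem_nthRoots hn).mpr hz.1
  have hopen : IsOpen (f ⁻¹' Sᶜ) := hSfin.isClosed.isOpen_compl.preimage hcont
  have hone : (1 : (InfiniteAdeleRing L)ˣ) ∈ f ⁻¹' Sᶜ := by simp [hf, hS]
  refine ⟨f ⁻¹' Sᶜ, hopen.mem_nhds hone, fun x hx => ?_⟩
  have hx' : f x ∉ S := hx
  have hfx : f x = 1 := by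
    by_contra hne
    exact hx' ⟨hpow x, hne⟩
  rw [HeckeCharacter.archFactor_apply]
  simp only [Pi.zero_apply, neg_zero, zpow_zero, mul_one, Finset.prod_const_one]
  exact hfx

/-- **The infinity type of a product is the sum of the infinity types.** -/
theorem HasInfinityType.mul' {χ ψ : HeckeCharacter L} {p q p' q' : InfinitePlace L → ℤ}
    (hχ : χ.HasInfinityType p q) (hψ : ψ.HasInfinityType p' q') :
    (χ * ψ).HasInfinityType (p + p') (q + q') := by
  obtain ⟨U, hU, hχU⟩ := hχ
  obtain ⟨V, hV, hψV⟩ := hψ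
  refine ⟨U ∩ V, Filter.inter_mem hU hV, fun x hx => ?_⟩
  rw [HeckeCharacter.mul_apply, Units.val_mul, hχU x hx.1, hψV x hx.2, HeckeCharacter.archFactor_apply,
    HeckeCharacter.archFactor_apply, HeckeCharacter.archFactor_apply, ← Finset.prod_mul_distrib]
  refine Finset.prod_congr rfl fun w _ => ?_
  have hz : extensionEmbedding w ((x : InfiniteAdeleRing L) w) ≠ 0 :=
    InfiniteIdele.extensionEmbedding_apply_ne_zero x w
  have hz' : conj (extensionEmbedding w ((x : InfiniteAdeleRing L) w)) ≠ 0 :=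
    (map_ne_zero (starRingEnd ℂ)).mpr hz
  simp only [Pi.add_apply, neg_add, zpow_add₀ hz, zpow_add₀ hz']
  ring

/-! ### Unitary archimedean type `(2k, 0)` is the infinity type `(-k, k)` -/

/-- `(z/|z|)^{2k} · |z|^{0·i} = z^k · z̄^{-k}` for `z ≠ 0`. -/
theorem archUnitaryValue_two_mul_zero {z : ℂ} (hz : z ≠ 0) (k : ℤ) :
    archUnitaryValue (2 * k) 0 z = z ^ k * conj z ^ (-k) := by
  have hn0 : (‖z‖ : ℂ) ≠ 0 := by exact_mod_cast (norm_ne_zero_iff.mpr hz)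
  have hcz : conj z ≠ 0 := (map_ne_zero (starRingEnd ℂ)).mpr hz
  have hsq : (z / (‖z‖ : ℂ)) ^ (2 : ℤ) = z * (conj z)⁻¹ := by
    have hnorm : (‖z‖ : ℂ) ^ 2 = z * conj z := by
      rw [← Complex.ofReal_pow, ← Complex.normSq_eq_norm_sq, ← Complex.mul_conj]
    rw [zpow_two]
    field_simp
    rw [sq] at hnorm ⊢
    linear_combination -hnorm
  rw [archUnitaryValue, Complex.ofReal_zero, zero_mul, Complex.cpow_zero, mul_one, zpow_mul, hsq, mul_zpow,
    inv_zpow', ]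

/-- **A Hecke character of unitary archimedean type `(2k, 0)` has infinity type `(-k, k)`**:
`ψ((x,1)) = ∏_w (ι_w x_w/|ι_w x_w|)^{2k_w} = ∏_w ι_w(x_w)^{k_w} \overline{ι_w(x_w)}^{-k_w}` on all of
`(L ⊗ ℝ)ˣ`, which is the archimedean factor `A_{-k,k}`. -/
theorem hasInfinityType_of_hasUnitaryArchType_two_mul {ψ : HeckeCharacter L} {k : InfinitePlace L → ℤ}
    (h : ψ.HasUnitaryArchType (fun w => 2 * k w) 0) :
    ψ.HasInfinityType (fun w => -k w) k := by
  refine ⟨Set.univ, Filter.univ_mem, fun x _ => ?_⟩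
  rw [h x, HeckeCharacter.archFactor_apply]
  refine Finset.prod_congr rfl fun w _ => ?_
  have hz : extensionEmbedding w ((x : InfiniteAdeleRing L) w) ≠ 0 :=
    InfiniteIdele.extensionEmbedding_apply_ne_zero x w
  rw [Pi.zero_apply, archUnitaryValue_two_mul_zero hz, neg_neg]

end Summit.Langlands.Langlands.Theorems.ResidualAutomorphyEven
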